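import Mathlib
import Summits.Ventures.PercRepro2.CoinChainXAMjGate

/-!
# The `mj′` and `m` gates of the (j, j′) pair
(blind cell PercRepro2, night-2 g30; §72.13)

`d' = d·1[{m, j'} ⊆ W]` is the `mj` gate with the roles of `j` and `j'` (and of the markers `x`, `y`)
exchanged; the cleared (XA′) is symmetric under that exchange (the product `x·y` commutes).  The `m` gate
`d' = d·1[m ∈ W]` is the fourth principal-filter corner: on the parts model `t·F = L·(s_x·s_y + L²·(t·XYM − XM·YM) + t·a·Px·Py)`.
-/

namespace Summit.Ventures.PercRepro2.Coin

open Classical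

section MjpGate

variable {V : Type*} [DecidableEq V] {R : Type*} [Field R] [LinearOrder R] [IsStrictOrderedRing R]

set_option maxHeartbeats 1600000 in
/-- **THE `mj′` GATE IS A THEOREM OF THE CHAIN** (the mirror of `chain_XA'_mj_gate`). -/
theorem chain_XA'_mjp_gate (U : Finset V) (m j j' : V) (ent' : Finset V) (ν c d : Finset V → R)
    (hj : j ∈ ent') (hj' : j' ∈ ent')
    (hν0 : ∀ W, 0 ≤ ν W) (hν : ∀ s ⊆ U, ∀ t ⊆ U, ν s * ν t ≤ ν (s ∩ t) * ν (s ∪ t))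
    (hc0 : ∀ W, 0 ≤ c W) (hd0 : ∀ W, 0 ≤ d W) (hdc : ∀ W, d W ≤ c W)
    (hcd : ∀ s t, c s * d t ≤ c (s ∩ t) * d (s ∪ t))
    (hratio : ∀ s t, s ⊆ t → d s * c t ≤ c s * d t)
    (hdd : ∀ s t, d s * d t ≤ d (s ∩ t) * d (s ∪ t))
    (x y : Finset V → R) (hx : ∀ W, x W = if j ∈ W then 1 else 0) (hy : ∀ W, y W = if j' ∈ W then 1 else 0) :
    (((∑ W ∈ U.powerset, ν W * chainMix {m} ent' 0 c d W) * (∑ W ∈ U.powerset, ν W * chainMix {m} ent' 1 c d W * x W) - (∑ W ∈ U.powerset, ν W * chainMix {m} ent' 0 c d W * x W) * (∑ W ∈ U.powerset, ν W * chainMix {m} ent' 1 c d W)) *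
          ((∑ W ∈ U.powerset, ν W * chainMix {m} ent' 0 c d W) * (∑ W ∈ U.powerset, ν W * chainMix {m} ent' 0 c (fun W => if m ∈ W ∧ j' ∈ W then d W else 0) W * y W) - (∑ W ∈ U.powerset, ν W * chainMix {m} ent' 0 c d W * y W) * (∑ W ∈ U.powerset, ν W * chainMix {m} ent' 0 c (fun W => if m ∈ W ∧ j' ∈ W then d W else 0) W))
        + ((∑ W ∈ U.powerset, ν W * chainMix {m} ent' 0 c d W) * (∑ W ∈ U.powerset, ν W * chainMix {m} ent' 1 c d W * y W) - (∑ W ∈ U.powerset, ν W * chainMix {m} ent' 0 c d W * y W) * (∑ W ∈ U.powerset, ν W * chainMix {m} ent' 1 c d W)) *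
          ((∑ W ∈ U.powerset, ν W * chainMix {m} ent' 0 c d W) * (∑ W ∈ U.powerset, ν W * chainMix {m} ent' 0 c (fun W => if m ∈ W ∧ j' ∈ W then d W else 0) W * x W) - (∑ W ∈ U.powerset, ν W * chainMix {m} ent' 0 c d W * x W) * (∑ W ∈ U.powerset, ν W * chainMix {m} ent' 0 c (fun W => if m ∈ W ∧ j' ∈ W then d W else 0) W))) ≤
        (∑ W ∈ U.powerset, ν W * chainMix {m} ent' 0 c d W) * ((∑ W ∈ U.powerset, ν W * chainMix {m} ent' 0 c d W) * (∑ W ∈ U.powerset, ν W * chainMix {m} ent' 0 c d W) * (∑ W ∈ U.powerset, ν W * chainMix {m} ent' 1 c (fun W => if m ∈ W ∧ j' ∈ W then d W else 0) W * (x W * y W))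
          - (∑ W ∈ U.powerset, ν W * chainMix {m} ent' 0 c d W) * (∑ W ∈ U.powerset, ν W * chainMix {m} ent' 0 c d W * y W) * (∑ W ∈ U.powerset, ν W * chainMix {m} ent' 1 c (fun W => if m ∈ W ∧ j' ∈ W then d W else 0) W * x W)
          - (∑ W ∈ U.powerset, ν W * chainMix {m} ent' 0 c d W) * (∑ W ∈ U.powerset, ν W * chainMix {m} ent' 0 c d W * x W) * (∑ W ∈ U.powerset, ν W * chainMix {m} ent' 1 c (fun W => if m ∈ W ∧ j' ∈ W then d W else 0) W * y W)
          + (∑ W ∈ U.powerset, ν W * chainMix {m} ent' 0 c d W * x W) * (∑ W ∈ U.powerset, ν W * chainMix {m} ent' 0 c d W * y W) * (∑ W ∈ U.powerset, ν W * chainMix {m} ent' 1 c (fun W => if m ∈ W ∧ j' ∈ W then d W else 0) W)) := by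
  have h := chain_XA'_mj_gate U m j' j ent' ν c d hj' hj hν0 hν hc0 hd0 hdc hcd hratio hdd y x hy hx
  have e : ∀ (ρ : R) (e : Finset V → R), ∑ W ∈ U.powerset, ν W * chainMix {m} ent' ρ c e W * (y W * x W) =
      ∑ W ∈ U.powerset, ν W * chainMix {m} ent' ρ c e W * (x W * y W) :=
    fun ρ e => Finset.sum_congr rfl (fun W _ => by ring)
  rw [e] at h
  linear_combination h

end MjpGate

section MGateAlg

variable {R : Type*} [Field R] [LinearOrder R] [IsStrictOrderedRing R]

/-- **The `m` gate on the parts model** (`d' = d·1[m ∈ W]`): `t·F = L·(s_x·s_y + L²·(t·XYM − XM·YM) + t·a·Px·Py)`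
with the `McM` slacks `s_x = L·XM − t·Px`, `s_y = L·YM − t·Py`. -/
theorem cg_m_full (a δ u t XJ XU XM YJ YU YM XYM : R)
    (ha : 0 ≤ a) (hδ : 0 ≤ δ) (hu : 0 ≤ u) (ht : 0 ≤ t) (hXJ : 0 ≤ XJ) (hXU : 0 ≤ XU) (hXM : 0 ≤ XM)
    (hYJ : 0 ≤ YJ) (hYU : 0 ≤ YU) (hYM : 0 ≤ YM)
    (hMcMx : 0 ≤ XM * (a + δ + u) - (XJ + XU) * t) (hMcMy : 0 ≤ YM * (a + δ + u) - (YJ + YU) * t)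
    (hXYM : 0 ≤ XYM) (hMM : 0 ≤ XYM * t - XM * YM) (hXMt : 0 ≤ t - XM) (hYMt : 0 ≤ t - YM) (hXYMx : 0 ≤ XM - XYM) :
    0 ≤ (a + δ + u + t) * ((a + δ + u + t) * (a + δ + u + t) * XYM - (a + δ + u + t) * (YJ + YU + YM) * XM - (a + δ + u + t) * (XJ + XU + XM) * YM + (XJ + XU + XM) * (YJ + YU + YM) * (a + t)) - (((a + δ + u + t) * (XU + XM) - (XJ + XU + XM) * (a + u + t)) * ((a + δ + u + t) * (YJ + YU + YM) - (YJ + YU + YM) * (a + δ + u + t)) + ((a + δ + u + t) * (YU + YM) - (YJ + YU + YM) * (a + u + t)) * ((a + δ + u + t) * (XJ + XU + XM) - (XJ + XU + XM) * (a + δ + u + t))) := by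
  have hL : 0 ≤ a + δ + u + t := by linarith
  have hPx : 0 ≤ XJ + XU + XM := by linarith
  have hPy : 0 ≤ YJ + YU + YM := by linarith
  rcases ht.lt_or_eq with htpos | ht0
  · have key : 0 ≤ t * ((a + δ + u + t) * ((a + δ + u + t) * (a + δ + u + t) * XYM - (a + δ + u + t) * (YJ + YU + YM) * XM - (a + δ + u + t) * (XJ + XU + XM) * YM + (XJ + XU + XM) * (YJ + YU + YM) * (a + t)) - (((a + δ + u + t) * (XU + XM) - (XJ + XU + XM) * (a + u + t)) * ((a + δ + u + t) * (YJ + YU + YM) - (YJ + YU + YM) * (a + δ + u + t)) + ((a + δ + u + t) * (YU + YM) - (YJ + YU + YM) * (a + u + t)) * ((a + δ + u + t) * (XJ + XU + XM) - (XJ + XU + XM) * (a + δ + u + t)))) := by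
      have e : t * ((a + δ + u + t) * ((a + δ + u + t) * (a + δ + u + t) * XYM - (a + δ + u + t) * (YJ + YU + YM) * XM - (a + δ + u + t) * (XJ + XU + XM) * YM + (XJ + XU + XM) * (YJ + YU + YM) * (a + t)) - (((a + δ + u + t) * (XU + XM) - (XJ + XU + XM) * (a + u + t)) * ((a + δ + u + t) * (YJ + YU + YM) - (YJ + YU + YM) * (a + δ + u + t)) + ((a + δ + u + t) * (YU + YM) - (YJ + YU + YM) * (a + u + t)) * ((a + δ + u + t) * (XJ + XU + XM) - (XJ + XU + XM) * (a + δ + u + t)))) = (a + δ + u + t) * ((XM * (a + δ + u) - (XJ + XU) * t) * (YM * (a + δ + u) - (YJ + YU) * t)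
          + (a + δ + u + t) * (a + δ + u + t) * (XYM * t - XM * YM) + t * a * (XJ + XU + XM) * (YJ + YU + YM)) := by ring
      rw [e]
      refine mul_nonneg hL (add_nonneg (add_nonneg (mul_nonneg hMcMx hMcMy) (mul_nonneg (mul_nonneg hL hL) hMM)) ?_)
      exact mul_nonneg (mul_nonneg (mul_nonneg ht ha) hPx) hPy
    exact (mul_nonneg_iff_of_pos_left htpos).mp key
  · have hXM0 : XM = 0 := le_antisymm (by linarith) hXM
    have hYM0 : YM = 0 := le_antisymm (by linarith) hYM
    have hXYM0 : XYM = 0 := le_antisymm (by linarith) hXYM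
    rw [← ht0, hXM0, hYM0, hXYM0]
    have : 0 ≤ (a + δ + u + 0) * ((XJ + XU + 0) * (YJ + YU + 0) * (a + 0)) :=
      mul_nonneg (by linarith) (mul_nonneg (mul_nonneg (by linarith) (by linarith)) (by linarith))
    linear_combination this

end MGateAlg

section MGateSums

variable {V : Type*} [DecidableEq V] {R : Type*} [Field R]
variable (U : Finset V) (m : V) (ent' : Finset V) (ν d : Finset V → R)

/-- The `m` gate vanishes on the clusters missing `m`. -/
theorem m_gate_D (z : Finset V → R) :
    ∑ W ∈ U.powerset.filter (fun W => (¬ ∃ r ∈ ({m} : Finset V), r ∈ W) ∧ ∃ r ∈ ent', r ∈ W), ν W * (if m ∈ W then d W else 0) * z W = 0 :=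
  Finset.sum_eq_zero (fun W hW => by
    have h := (Finset.mem_filter.1 hW).2
    rw [if_neg (fun hm => h.1 ⟨m, Finset.mem_singleton_self m, hm⟩)]; ring)

/-- The `m` gate vanishes on the clusters missing `m` (no marker). -/
theorem m_gate_D' :
    ∑ W ∈ U.powerset.filter (fun W => (¬ ∃ r ∈ ({m} : Finset V), r ∈ W) ∧ ∃ r ∈ ent', r ∈ W), ν W * (if m ∈ W then d W else 0) = 0 :=
  Finset.sum_eq_zero (fun W hW => by
    have h := (Finset.mem_filter.1 hW).2
    rw [if_neg (fun hm => h.1 ⟨m, Finset.mem_singleton_self m, hm⟩)]; ring)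

/-- On the `m`-clusters the `m` gate is `d`. -/
theorem m_gate_M (z : Finset V → R) :
    ∑ W ∈ U.powerset.filter (fun W => ∃ r ∈ ({m} : Finset V), r ∈ W), ν W * (if m ∈ W then d W else 0) * z W =
      ∑ W ∈ U.powerset.filter (fun W => ∃ r ∈ ({m} : Finset V), r ∈ W), ν W * d W * z W :=
  Finset.sum_congr rfl (fun W hW => by
    obtain ⟨r, hr, hrW⟩ := (Finset.mem_filter.1 hW).2
    rw [if_pos (Finset.mem_singleton.1 hr ▸ hrW)])

/-- On the `m`-clusters the `m` gate is `d` (no marker). -/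
theorem m_gate_M' :
    ∑ W ∈ U.powerset.filter (fun W => ∃ r ∈ ({m} : Finset V), r ∈ W), ν W * (if m ∈ W then d W else 0) =
      ∑ W ∈ U.powerset.filter (fun W => ∃ r ∈ ({m} : Finset V), r ∈ W), ν W * d W :=
  Finset.sum_congr rfl (fun W hW => by
    obtain ⟨r, hr, hrW⟩ := (Finset.mem_filter.1 hW).2
    rw [if_pos (Finset.mem_singleton.1 hr ▸ hrW)])

end MGateSums

section MGateMain

variable {V : Type*} [DecidableEq V] {R : Type*} [Field R] [LinearOrder R] [IsStrictOrderedRing R]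

set_option maxHeartbeats 1600000 in
/-- **THE `m` GATE IS A THEOREM OF THE CHAIN**: `d' = d·1[m ∈ W]` (the gate fully open on the
sure-entered clusters, closed on the coin-entered ones): the cleared (XA′) under `hν0`, `hν`, `hc0`,
`hd0`, `hdc`, `hcd`, `hdd` — two `McM` facts and the sure-entered fact `XM·YM ≤ t·XYM`. -/
theorem chain_XA'_m_gate (U : Finset V) (m j j' : V) (ent' : Finset V) (ν c d : Finset V → R)
    (hj : j ∈ ent') (hj' : j' ∈ ent')
    (hν0 : ∀ W, 0 ≤ ν W) (hν : ∀ s ⊆ U, ∀ t ⊆ U, ν s * ν t ≤ ν (s ∩ t) * ν (s ∪ t))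
    (hc0 : ∀ W, 0 ≤ c W) (hd0 : ∀ W, 0 ≤ d W) (hdc : ∀ W, d W ≤ c W)
    (hcd : ∀ s t, c s * d t ≤ c (s ∩ t) * d (s ∪ t))
    (hdd : ∀ s t, d s * d t ≤ d (s ∩ t) * d (s ∪ t))
    (x y : Finset V → R) (hx : ∀ W, x W = if j ∈ W then 1 else 0) (hy : ∀ W, y W = if j' ∈ W then 1 else 0) :
    (((∑ W ∈ U.powerset, ν W * chainMix {m} ent' 0 c d W) * (∑ W ∈ U.powerset, ν W * chainMix {m} ent' 1 c d W * x W) - (∑ W ∈ U.powerset, ν W * chainMix {m} ent' 0 c d W * x W) * (∑ W ∈ U.powerset, ν W * chainMix {m} ent' 1 c d W)) *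
          ((∑ W ∈ U.powerset, ν W * chainMix {m} ent' 0 c d W) * (∑ W ∈ U.powerset, ν W * chainMix {m} ent' 0 c (fun W => if m ∈ W then d W else 0) W * y W) - (∑ W ∈ U.powerset, ν W * chainMix {m} ent' 0 c d W * y W) * (∑ W ∈ U.powerset, ν W * chainMix {m} ent' 0 c (fun W => if m ∈ W then d W else 0) W))
        + ((∑ W ∈ U.powerset, ν W * chainMix {m} ent' 0 c d W) * (∑ W ∈ U.powerset, ν W * chainMix {m} ent' 1 c d W * y W) - (∑ W ∈ U.powerset, ν W * chainMix {m} ent' 0 c d W * y W) * (∑ W ∈ U.powerset, ν W * chainMix {m} ent' 1 c d W)) *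
          ((∑ W ∈ U.powerset, ν W * chainMix {m} ent' 0 c d W) * (∑ W ∈ U.powerset, ν W * chainMix {m} ent' 0 c (fun W => if m ∈ W then d W else 0) W * x W) - (∑ W ∈ U.powerset, ν W * chainMix {m} ent' 0 c d W * x W) * (∑ W ∈ U.powerset, ν W * chainMix {m} ent' 0 c (fun W => if m ∈ W then d W else 0) W))) ≤
        (∑ W ∈ U.powerset, ν W * chainMix {m} ent' 0 c d W) * ((∑ W ∈ U.powerset, ν W * chainMix {m} ent' 0 c d W) * (∑ W ∈ U.powerset, ν W * chainMix {m} ent' 0 c d W) * (∑ W ∈ U.powerset, ν W * chainMix {m} ent' 1 c (fun W => if m ∈ W then d W else 0) W * (x W * y W))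
          - (∑ W ∈ U.powerset, ν W * chainMix {m} ent' 0 c d W) * (∑ W ∈ U.powerset, ν W * chainMix {m} ent' 0 c d W * y W) * (∑ W ∈ U.powerset, ν W * chainMix {m} ent' 1 c (fun W => if m ∈ W then d W else 0) W * x W)
          - (∑ W ∈ U.powerset, ν W * chainMix {m} ent' 0 c d W) * (∑ W ∈ U.powerset, ν W * chainMix {m} ent' 0 c d W * x W) * (∑ W ∈ U.powerset, ν W * chainMix {m} ent' 1 c (fun W => if m ∈ W then d W else 0) W * y W)
          + (∑ W ∈ U.powerset, ν W * chainMix {m} ent' 0 c d W * x W) * (∑ W ∈ U.powerset, ν W * chainMix {m} ent' 0 c d W * y W) * (∑ W ∈ U.powerset, ν W * chainMix {m} ent' 1 c (fun W => if m ∈ W then d W else 0) W)) := by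
  have hx0 : ∀ W, 0 ≤ x W := fun W => by rw [hx W]; split_ifs <;> norm_num
  have hy0 : ∀ W, 0 ≤ y W := fun W => by rw [hy W]; split_ifs <;> norm_num
  have hx1 : ∀ W, x W ≤ 1 := fun W => by rw [hx W]; split_ifs <;> norm_num
  have hy1 : ∀ W, y W ≤ 1 := fun W => by rw [hy W]; split_ifs <;> norm_num
  have hxm : ∀ s t, x s ≤ x (s ∪ t) := fun s t => by
    rw [hx s, hx (s ∪ t)]
    by_cases h : j ∈ s
    · rw [if_pos h, if_pos (Finset.mem_union_left t h)]
    · rw [if_neg h]; split_ifs <;> norm_num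
  have hym : ∀ s t, y s ≤ y (s ∪ t) := fun s t => by
    rw [hy s, hy (s ∪ t)]
    by_cases h : j' ∈ s
    · rw [if_pos h, if_pos (Finset.mem_union_left t h)]
    · rw [if_neg h]; split_ifs <;> norm_num
  refine chain_XA'_gate_of_parts U m j j' ent' ν c d (fun W => if m ∈ W then d W else 0) hj hj' x y hx hy ?_
  have eD0 := m_gate_D' U m ent' ν d
  have eDx := m_gate_D U m ent' ν d x
  have eDy := m_gate_D U m ent' ν d y
  have eDxy := m_gate_D U m ent' ν d (fun W => x W * y W)
  have eM0 := m_gate_M' U m ν d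
  have eMx := m_gate_M U m ν d x
  have eMy := m_gate_M U m ν d y
  have eMxy := m_gate_M U m ν d (fun W => x W * y W)
  beta_reduce at eDxy eMxy
  rw [eD0, eDx, eDy, eDxy, eM0, eMx, eMy, eMxy]
  set a := (∑ W ∈ U.powerset.filter (fun W => ¬ ∃ r ∈ ({m} : Finset V) ∪ ent', r ∈ W), ν W * c W) with ha_def
  set δ := (∑ W ∈ U.powerset.filter (fun W => (¬ ∃ r ∈ ({m} : Finset V), r ∈ W) ∧ ∃ r ∈ ent', r ∈ W), ν W * (c W - d W)) with hδ_def
  set u := (∑ W ∈ U.powerset.filter (fun W => (¬ ∃ r ∈ ({m} : Finset V), r ∈ W) ∧ ∃ r ∈ ent', r ∈ W), ν W * d W) with hu_def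
  set t := (∑ W ∈ U.powerset.filter (fun W => ∃ r ∈ ({m} : Finset V), r ∈ W), ν W * d W) with ht_def
  set XJ := (∑ W ∈ U.powerset.filter (fun W => (¬ ∃ r ∈ ({m} : Finset V), r ∈ W) ∧ ∃ r ∈ ent', r ∈ W), ν W * (c W - d W) * x W) with hXJ_def
  set XU := (∑ W ∈ U.powerset.filter (fun W => (¬ ∃ r ∈ ({m} : Finset V), r ∈ W) ∧ ∃ r ∈ ent', r ∈ W), ν W * d W * x W) with hXU_def
  set XM := (∑ W ∈ U.powerset.filter (fun W => ∃ r ∈ ({m} : Finset V), r ∈ W), ν W * d W * x W) with hXM_def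
  set YJ := (∑ W ∈ U.powerset.filter (fun W => (¬ ∃ r ∈ ({m} : Finset V), r ∈ W) ∧ ∃ r ∈ ent', r ∈ W), ν W * (c W - d W) * y W) with hYJ_def
  set YU := (∑ W ∈ U.powerset.filter (fun W => (¬ ∃ r ∈ ({m} : Finset V), r ∈ W) ∧ ∃ r ∈ ent', r ∈ W), ν W * d W * y W) with hYU_def
  set YM := (∑ W ∈ U.powerset.filter (fun W => ∃ r ∈ ({m} : Finset V), r ∈ W), ν W * d W * y W) with hYM_def
  set XYM := (∑ W ∈ U.powerset.filter (fun W => ∃ r ∈ ({m} : Finset V), r ∈ W), ν W * d W * (x W * y W)) with hXYM_def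
  have hcd0 : ∀ W, 0 ≤ c W - d W := fun W => by linarith [hdc W]
  have ha : 0 ≤ a := Finset.sum_nonneg (fun W _ => mul_nonneg (hν0 W) (hc0 W))
  have hδ : 0 ≤ δ := Finset.sum_nonneg (fun W _ => mul_nonneg (hν0 W) (hcd0 W))
  have hu : 0 ≤ u := Finset.sum_nonneg (fun W _ => mul_nonneg (hν0 W) (hd0 W))
  have ht : 0 ≤ t := Finset.sum_nonneg (fun W _ => mul_nonneg (hν0 W) (hd0 W))
  have hXJ : 0 ≤ XJ := Finset.sum_nonneg (fun W _ => mul_nonneg (mul_nonneg (hν0 W) (hcd0 W)) (hx0 W))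
  have hXU : 0 ≤ XU := Finset.sum_nonneg (fun W _ => mul_nonneg (mul_nonneg (hν0 W) (hd0 W)) (hx0 W))
  have hXM : 0 ≤ XM := Finset.sum_nonneg (fun W _ => mul_nonneg (mul_nonneg (hν0 W) (hd0 W)) (hx0 W))
  have hYJ : 0 ≤ YJ := Finset.sum_nonneg (fun W _ => mul_nonneg (mul_nonneg (hν0 W) (hcd0 W)) (hy0 W))
  have hYU : 0 ≤ YU := Finset.sum_nonneg (fun W _ => mul_nonneg (mul_nonneg (hν0 W) (hd0 W)) (hy0 W))
  have hYM : 0 ≤ YM := Finset.sum_nonneg (fun W _ => mul_nonneg (mul_nonneg (hν0 W) (hd0 W)) (hy0 W))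
  have hXMt : XM ≤ t := Finset.sum_le_sum (fun W _ => mul_le_of_le_one_right (mul_nonneg (hν0 W) (hd0 W)) (hx1 W))
  have hYMt : YM ≤ t := Finset.sum_le_sum (fun W _ => mul_le_of_le_one_right (mul_nonneg (hν0 W) (hd0 W)) (hy1 W))
  have hXYMx : XYM ≤ XM := Finset.sum_le_sum (fun W _ => by
    calc ν W * d W * (x W * y W) = (ν W * d W * x W) * y W := by ring
      _ ≤ ν W * d W * x W := mul_le_of_le_one_right (mul_nonneg (mul_nonneg (hν0 W) (hd0 W)) (hx0 W)) (hy1 W))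
  have FMx := cg_fact_McM U {m} ent' ν c d hν0 hν hc0 hd0 hcd x hx0 hxm
  have FMy := cg_fact_McM U {m} ent' ν c d hν0 hν hc0 hd0 hcd y hy0 hym
  rw [sum_entfree_split U {m} ent' (fun W => ν W * c W), cg_split' U ν c d (fun W => (¬ ∃ r ∈ ({m} : Finset V), r ∈ W) ∧ ∃ r ∈ ent', r ∈ W), cg_split U ν c d (fun W => (¬ ∃ r ∈ ({m} : Finset V), r ∈ W) ∧ ∃ r ∈ ent', r ∈ W) x] at FMx
  rw [sum_entfree_split U {m} ent' (fun W => ν W * c W), cg_split' U ν c d (fun W => (¬ ∃ r ∈ ({m} : Finset V), r ∈ W) ∧ ∃ r ∈ ent', r ∈ W), cg_split U ν c d (fun W => (¬ ∃ r ∈ ({m} : Finset V), r ∈ W) ∧ ∃ r ∈ ent', r ∈ W) y] at FMy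
  have FMM := cg_fact_MM U ν d hν0 hν hd0 hdd m x y hx0 hy0 hxm hym
  have hXYM : 0 ≤ XYM := Finset.sum_nonneg (fun W _ => mul_nonneg (mul_nonneg (hν0 W) (hd0 W)) (mul_nonneg (hx0 W) (hy0 W)))
  have key := cg_m_full a δ u t XJ XU XM YJ YU YM XYM ha hδ hu ht hXJ hXU hXM hYJ hYU hYM
    (by linear_combination FMx) (by linear_combination FMy) hXYM (by linear_combination FMM) (by linarith) (by linarith) (by linarith)
  linear_combination key

end MGateMain

end Summit.Ventures.PercRepro2.Coin
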